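import Mathlib.Combinatorics.Matroid.Rank.ENat
import Mathlib.Combinatorics.Matroid.Circuit
import Mathlib.Tactic.Ring

/-!
# PercRepro — S2: A SET OF NULLITY `1` CONTAINS EXACTLY ONE CIRCUIT — THE HITTING HALF OF THE COINDEPENDENCE LEVER
(p7, gen 9; generic, for S1 / S2 / S3)

On the `U`-side of `C025` at level `q` on a core of nullity `d` (`|E| = ρ(E) + d`), a counted set `B` of size `d − 1`
with spanning complement has `|E \ B| = ρ(E) + 1`: the complement is a basis plus ONE element, so it contains exactly
one circuit (`fundCircuit`), and EVERY OTHER circuit of `M` meets `B`. This is what the union bound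
`Σ_k s_k · C(n − k, q + 1 − k)` over the small circuits ignores: a `6`-set `B = C ∪ X` of a rank-`16` core on `23`
points is in `U` only if `X` (three points for a triangle `C`) meets all circuits disjoint from `C` but one —
with `7` pairwise disjoint triangles no such `B` exists, while the union bound charges `7 · C(20, 3)`.

* `eq_of_isCircuit_subset_of_nullity_one` — `|X| = ρ(X) + 1`, two circuits inside `X` ⟹ they are equal;
* `isCircuit_eq_of_disjoint_of_spanning_compl` — the same for `X = E \ B` with `B` coindependent of size `d − 1`;
* `isCircuit_inter_nonempty_of_ne_of_spanning_compl` — every circuit other than the one in `E \ B` meets `B`.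
Axioms: standard.
-/

open scoped Matroid

namespace PercRepro

namespace S2

open Set

variable {α : Type}

/-- **A set of nullity `1` contains exactly one circuit**: if `X ⊆ E` is finite with `|X| = ρ(X) + 1`, then any two
circuits contained in `X` coincide (both are the fundamental circuit of the extra element w.r.t. a basis of `X`). -/
theorem eq_of_isCircuit_subset_of_nullity_one (M : Matroid α) {X C C' : Set α} (hX : X ⊆ M.E) (hXfin : X.Finite)
    (h1 : X.encard = M.eRk X + 1) (hC : M.IsCircuit C) (hCX : C ⊆ X) (hC' : M.IsCircuit C') (hC'X : C' ⊆ X) :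
    C = C' := by
  obtain ⟨I, hI⟩ := M.exists_isBasis X hX
  have hIcard : I.encard = M.eRk X := hI.encard_eq_eRk
  have hsum : (X \ I).encard + I.encard = X.encard := encard_sdiff_add_encard_of_subset hI.subset
  have hrk : M.eRk X ≠ ⊤ := by
    refine ne_top_of_le_ne_top ?_ (M.eRk_le_encard X)
    exact hXfin.encard_lt_top.ne
  have hdiff : (X \ I).encard = 1 := by
    rw [hIcard, h1] at hsum
    exact WithTop.add_right_cancel hrk (hsum.trans (add_comm _ _))
  obtain ⟨e, he⟩ := encard_eq_one.1 hdiff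
  have hXe : X = insert e I := by
    rw [← union_singleton, ← he]
    exact (union_sdiff_cancel hI.subset).symm
  rw [hC.eq_fundCircuit_of_subset hI.indep (by rw [← hXe]; exact hCX),
    hC'.eq_fundCircuit_of_subset hI.indep (by rw [← hXe]; exact hC'X)]

/-- **The complement of a coindependent set of size `d − 1` carries exactly one circuit**: on a core of nullity
`d = k + 1` (`|E| = ρ(E) + k + 1`), if `B ⊆ E` has `|B| = k` and `E \ B` spans, then any two circuits disjoint
from `B` coincide. -/
theorem isCircuit_eq_of_disjoint_of_spanning_compl (M : Matroid α) [M.Finite] {B C C' : Set α} {k : ℕ}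
    (hB : B ⊆ M.E) (hd : M.E.encard = M.eRank + (k + 1)) (hBk : B.encard = k) (hBs : M.eRk (M.E \ B) = M.eRank)
    (hC : M.IsCircuit C) (hCB : Disjoint C B) (hC' : M.IsCircuit C') (hC'B : Disjoint C' B) : C = C' := by
  have hXfin : (M.E \ B).Finite := M.ground_finite.subset sdiff_subset
  have hsum : (M.E \ B).encard + B.encard = M.E.encard := encard_sdiff_add_encard_of_subset hB
  have h1 : (M.E \ B).encard = M.eRk (M.E \ B) + 1 := by
    rw [hBs]
    rw [hBk, hd] at hsum
    have hk : (k : ℕ∞) ≠ ⊤ := WithTop.natCast_ne_top k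
    have : (M.E \ B).encard + (k : ℕ∞) = (M.eRank + 1) + (k : ℕ∞) := by
      rw [hsum]; ring
    exact WithTop.add_right_cancel hk this
  exact eq_of_isCircuit_subset_of_nullity_one M sdiff_subset hXfin h1 hC
    (subset_sdiff.2 ⟨hC.subset_ground, hCB⟩) hC' (subset_sdiff.2 ⟨hC'.subset_ground, hC'B⟩)

/-- **Every circuit other than the one in the complement meets `B`**: with `B` as above and `C₀` the circuit of
`E \ B`, every circuit `C ≠ C₀` of `M` meets `B`. -/
theorem isCircuit_inter_nonempty_of_ne_of_spanning_compl (M : Matroid α) [M.Finite] {B C C₀ : Set α} {k : ℕ}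
    (hB : B ⊆ M.E) (hd : M.E.encard = M.eRank + (k + 1)) (hBk : B.encard = k) (hBs : M.eRk (M.E \ B) = M.eRank)
    (hC₀ : M.IsCircuit C₀) (hC₀B : Disjoint C₀ B) (hC : M.IsCircuit C) (hne : C ≠ C₀) : (C ∩ B).Nonempty := by
  by_contra hcon
  rw [not_nonempty_iff_eq_empty, ← disjoint_iff_inter_eq_empty] at hcon
  exact hne (isCircuit_eq_of_disjoint_of_spanning_compl M hB hd hBk hBs hC hcon hC₀ hC₀B)

end S2

end PercRepro
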